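import Literature.Barriers.CriticalPhenomena.LongRangeTrivialityOnZ3GaussianMGF
import Literature.Barriers.CriticalPhenomena.LongRangeTrivialityOnZ3UrsellSum
import Literature.Barriers.CriticalPhenomena.LongRangeTrivialityOnZ3MMSWalk
import Literature.Barriers.CriticalPhenomena.LongRangeTrivialityOnZ3TwoPointProofs

/-!
# Panis's moment-generating-function bound without Newman's inequality: the summation step with
# the Gaussian domination of the moment generating function (GHS), and the reduced trust base

Sibling of `Literature/Barriers/CriticalPhenomena/LongRangeTrivialityOnZ3.lean` (barrier catalogue
D-0021, sub-problem `Ising3DConformalLimit`). `LongRangeTrivialityOnZ3Moments.lean` proves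
`panis_mgfDeviation_le_ursellFourBoxSum` (the second display of the proof of Panis 2023, Theorem 5.5,
p. 21 of arXiv:2309.05797 — one of the two inputs of `panis_thm12` in `…Inputs`) from Aizenman's
deviation display `panis_evenMoment_deviation_le` AND Newman's Gaussian domination of the even moments
`newman_gaussian_evenMoment_le` (Newman 1975, Lee–Yang). `LongRangeTrivialityOnZ3GaussianMGF.lean`
proves, from the GHS inequality, the moment-generating-function form of that domination for the
smeared observables `T_{|f|,L,β}` (`LongRangeIsing.state_exp_smeared_le_of_ghs`). This file redoes the
summation with that input:

* `abs_mgf_sub_exp_le_of_mgf_bound` — the pure-probability summation theorem of the tree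
  (`Literature.Probability.LatticeModels.abs_mgf_sub_exp_le_of_moment_bounds`, ADC §6.3 / Panis p. 21) with
  hypothesis (iii) "term-by-term Gaussian domination of the even moments of `Y`" replaced by
  (iii') `E[exp(tY)] ≤ exp(t²E[Y²]/2)` for all real `t` (and `Y` bounded): the majorant series
  `∑_n z^{2n}E[Y^{2n}]/(2n)!` is `(E[e^{zY}] + E[e^{-zY}])/2 ≤ exp(z²E[Y²]/2)`; the rest of the proof
  is the tree's, verbatim;
* `panis_mgfDeviation_le_ursellFourBoxSum_of_ghs : panis_evenMoment_deviation_le →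
  panis_mgfDeviation_le_ursellFourBoxSum` (window law, flip symmetry and bookkeeping of `…Moments`);
* `panis_thm12_of_ghs : panis_evenMoment_deviation_le → panis_ursellFourBoxSum_le → panis_thm12`;
* on `ℤ³`, with the `d = 3` assembly of `…UrsellSum` and the discharges
  `panis_mms_two_point_monotone_holds` (`…MMSWalk`) and `panis_boxSusceptibility_le_blockVariance_holds`
  (`…TwoPointProofs`): `panis_thm12_dim3_of_ghs` and **`LongRangeTrivialityOnZ3.of_ghs`** — the barrier
  from FOUR printed facts: `panis_evenMoment_deviation_le` (Prop. 4.6 smeared, random currents),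
  `panis_treeDiagramBound` (Aizenman 1982), `panis_slidingScale_infraredBound` (Thm. 3.18 [ADC]) and
  `panis_infraredBound_algebraic` (Prop. 3.8, p. 16).

So `newman_gaussian_evenMoment_le` is no longer in the trust base of `panis_thm12` or of the barrier.

## References

* R. Panis, arXiv:2309.05797 (2023) = Ann. Probab. 54 (2026), proof of Theorem 5.5, first two displays
  (p. 21); Theorem 1.2 [Panis2023Triviality] (held; read pp. 21–22).
* M. Aizenman, H. Duminil-Copin, Ann. Math. 194 (2021), §6.3 (the summation, nearest-neighbour)
  [AizenmanDuminilCopinAnnals2021] — through the tree's summation theorem.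
* C. M. Newman, Comm. Math. Phys. 41 (1975) 1–9, Theorem 5, eq. (2.8) [Newman1975] (the input replaced).
* J. L. Lebowitz, Comm. Math. Phys. 35 (1974) 87–92, eq. (1.8) (GHS) [Lebowitz1974].
-/

noncomputable section

namespace Literature.Barriers.CriticalPhenomena

open Literature.Probability.LatticeModels Literature.Probability.Percolation Filter Topology Finset MeasureTheory
open scoped symmDiff ENNReal Nat

/-! ### The summation step with the moment-generating-function form of the Gaussian domination -/

/-- **Summation step of ADC §6.3 / Panis Thm 5.5, moment-generating-function form of hypothesis
(iii)** (pure probability). Let `X, Y` be bounded random variables on a probability space such that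
(i) the odd moments of `X` vanish, (ii) for `n ≥ 2`,
`|E[X^{2n}] - (2n)!/(2ⁿn!) E[X²]ⁿ| ≤ (2n)⁴ E · E[Y^{2n-4}]`, and (iii') the moment generating function
of `Y` is dominated by the Gaussian one, `E[exp(tY)] ≤ exp(t² E[Y²]/2)` for all real `t`. Then
`|E[exp(zX)] - exp(z² E[X²]/2)| ≤ 16 E z⁴ exp(z² E[Y²]/2)` for every real `z`
(as `abs_mgf_sub_exp_le_of_moment_bounds`, whose hypothesis (iii) — term-by-term domination of the even
moments of `Y` — is only used through `∑_n z^{2n}E[Y^{2n}]/(2n)! = E[cosh zY] ≤ exp(z²E[Y²]/2)`).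
[cite: AizenmanDuminilCopinAnnals2021, arXiv:1912.07973 §6.3 (p. 26)] [cite: Panis2023Triviality, proof of Theorem 5.5, first two displays (p. 21)] -/
theorem abs_mgf_sub_exp_le_of_mgf_bound {Ω : Type*} [MeasurableSpace Ω] {μ : Measure Ω}
    [IsProbabilityMeasure μ] {X Y : Ω → ℝ} (hXm : Measurable X)
    {K : ℝ} (hXb : ∀ ω, |X ω| ≤ K) (hYm : Measurable Y) {K' : ℝ} (hYb : ∀ ω, |Y ω| ≤ K')
    {E : ℝ} (hE : 0 ≤ E)
    (hdev : ∀ n : ℕ, 2 ≤ n →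
      |(∫ ω, X ω ^ (2 * n) ∂μ) - ((2 * n)! : ℝ) / (2 ^ n * n !) * (∫ ω, X ω ^ 2 ∂μ) ^ n|
        ≤ (2 * n : ℝ) ^ 4 * E * ∫ ω, Y ω ^ (2 * n - 4) ∂μ)
    (hmgf : ∀ t : ℝ, ∫ ω, Real.exp (t * Y ω) ∂μ ≤ Real.exp (t ^ 2 / 2 * ∫ ω, Y ω ^ 2 ∂μ))
    (hodd : ∀ n : ℕ, ∫ ω, X ω ^ (2 * n + 1) ∂μ = 0) (z : ℝ) :
    |(∫ ω, Real.exp (z * X ω) ∂μ) - Real.exp (z ^ 2 / 2 * ∫ ω, X ω ^ 2 ∂μ)|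
      ≤ 16 * E * z ^ 4 * Real.exp (z ^ 2 / 2 * ∫ ω, Y ω ^ 2 ∂μ) := by
  set V : ℝ := ∫ ω, X ω ^ 2 ∂μ with hV
  set W : ℝ := ∫ ω, Y ω ^ 2 ∂μ with hW
  set m : ℕ → ℝ := fun k => ∫ ω, X ω ^ k ∂μ with hm
  set w : ℕ → ℝ := fun n => ∫ ω, Y ω ^ (2 * n) ∂μ with hw
  have hm2 : m 2 = V := rfl
  -- even-moment series for the exponential moment of `X`
  have h1 : HasSum (fun k : ℕ => z ^ k / k ! * m k) (∫ ω, Real.exp (z * X ω) ∂μ) :=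
    hasSum_integral_pow_div_factorial μ hXm hXb z
  have h2 : HasSum (fun n : ℕ => z ^ (2 * n) / (2 * n)! * m (2 * n))
      (∫ ω, Real.exp (z * X ω) ∂μ) := by
    have key := (Function.Injective.hasSum_iff (mul_right_injective₀ (two_ne_zero' ℕ))
      (f := fun k : ℕ => z ^ k / k ! * m k) (a := ∫ ω, Real.exp (z * X ω) ∂μ) ?_).mpr h1
    · simpa only [Function.comp_def] using key
    · intro k hk
      rcases Nat.even_or_odd k with ⟨j, hj⟩ | ⟨j, hj⟩
      · exact absurd ⟨j, show 2 * j = k by omega⟩ hk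
      · subst hj
        simp only [hm, hodd j, mul_zero]
  -- the Gaussian series `exp(z² V/2) = ∑ z^{2n}/(2n)! · (2n)!/(2ⁿ n!) Vⁿ`
  have hexp2 : ∀ a : ℝ, HasSum (fun n : ℕ => (z ^ 2 / 2 * a) ^ n / n !)
      (Real.exp (z ^ 2 / 2 * a)) := fun a => by
    rw [Real.exp_eq_exp_ℝ]
    exact NormedSpace.expSeries_div_hasSum_exp _
  have hterm : ∀ (a : ℝ) (n : ℕ), z ^ (2 * n) / (2 * n)! * (((2 * n)! : ℝ) / (2 ^ n * n !) * a ^ n)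
      = (z ^ 2 / 2 * a) ^ n / n ! := fun a n => by
    have hn : ((2 * n)! : ℝ) ≠ 0 := by positivity
    rw [pow_mul, show z ^ 2 / 2 * a = z ^ 2 * a / 2 by ring, div_pow, mul_pow]
    field_simp
  have h3 : HasSum (fun n : ℕ => z ^ (2 * n) / (2 * n)! * (((2 * n)! : ℝ) / (2 ^ n * n !) * V ^ n))
      (Real.exp (z ^ 2 / 2 * V)) := by
    simp_rw [hterm V]
    exact hexp2 V
  -- the difference series
  have h4 : HasSum (fun n : ℕ => z ^ (2 * n) / (2 * n)! *
      (m (2 * n) - ((2 * n)! : ℝ) / (2 ^ n * n !) * V ^ n))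
      ((∫ ω, Real.exp (z * X ω) ∂μ) - Real.exp (z ^ 2 / 2 * V)) := by
    have h4' := h2.sub h3
    simp only [← mul_sub] at h4'
    exact h4'
  -- the majorant series `c_n = z^{2n}/(2n)! E[Y^{2n}]`: it sums to `E[cosh zY] ≤ exp(z² W/2)`
  have hz2 : ∀ n : ℕ, 0 ≤ z ^ (2 * n) := fun n => by rw [pow_mul]; positivity
  have hw0 : ∀ n, 0 ≤ w n := fun n => integral_nonneg fun ω => by
    show 0 ≤ Y ω ^ (2 * n)
    rw [pow_mul]; positivity
  have hY1 : HasSum (fun k : ℕ => z ^ k / k ! * ∫ ω, Y ω ^ k ∂μ) (∫ ω, Real.exp (z * Y ω) ∂μ) :=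
    hasSum_integral_pow_div_factorial μ hYm hYb z
  have hY2 : HasSum (fun k : ℕ => (-z) ^ k / k ! * ∫ ω, Y ω ^ k ∂μ) (∫ ω, Real.exp (-z * Y ω) ∂μ) :=
    hasSum_integral_pow_div_factorial μ hYm hYb (-z)
  have hY3 : HasSum (fun k : ℕ => (z ^ k + (-z) ^ k) / k ! * ∫ ω, Y ω ^ k ∂μ)
      ((∫ ω, Real.exp (z * Y ω) ∂μ) + ∫ ω, Real.exp (-z * Y ω) ∂μ) := by
    have h := hY1.add hY2
    refine h.congr_fun fun k => ?_
    ring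
  have hc_hasSum : HasSum (fun n : ℕ => z ^ (2 * n) / (2 * n)! * w n)
      (((∫ ω, Real.exp (z * Y ω) ∂μ) + ∫ ω, Real.exp (-z * Y ω) ∂μ) / 2) := by
    have key := (Function.Injective.hasSum_iff (mul_right_injective₀ (two_ne_zero' ℕ))
      (f := fun k : ℕ => (z ^ k + (-z) ^ k) / k ! * ∫ ω, Y ω ^ k ∂μ)
      (a := (∫ ω, Real.exp (z * Y ω) ∂μ) + ∫ ω, Real.exp (-z * Y ω) ∂μ) ?_).mpr hY3
    · have key2 := key.div_const 2
      refine key2.congr_fun fun n => ?_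
      simp only [Function.comp_apply, hw]
      rw [Even.neg_pow ⟨n, by ring⟩]
      ring
    · intro k hk
      rcases Nat.even_or_odd k with ⟨j, hj⟩ | ⟨j, hj⟩
      · exact absurd ⟨j, show 2 * j = k by omega⟩ hk
      · subst hj
        rw [Odd.neg_pow ⟨j, rfl⟩, add_neg_cancel, zero_div, zero_mul]
  have hc_sum : Summable fun n => z ^ (2 * n) / (2 * n)! * w n := hc_hasSum.summable
  have hc_tsum : ∑' n, z ^ (2 * n) / (2 * n)! * w n ≤ Real.exp (z ^ 2 / 2 * W) := by
    rw [hc_hasSum.tsum_eq]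
    have ha := hmgf z
    have hb := hmgf (-z)
    rw [neg_sq] at hb
    have : (fun ω => Real.exp (-z * Y ω)) = fun ω => Real.exp (-z * Y ω) := rfl
    linarith
  -- the shifted majorant `b`
  set b : ℕ → ℝ := fun n => if n < 2 then 0 else
    16 * E * z ^ 4 * (z ^ (2 * (n - 2)) / (2 * (n - 2))! * w (n - 2)) with hb_def
  have hb : HasSum b (16 * E * z ^ 4 * ∑' n, z ^ (2 * n) / (2 * n)! * w n) := by
    rw [← hasSum_nat_add_iff' 2]
    have h0 : ∑ i ∈ Finset.range 2, b i = 0 := by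
      simp [hb_def, Finset.sum_range_succ]
    rw [h0, sub_zero]
    have hshift : (fun n => b (n + 2)) = fun n => 16 * E * z ^ 4 * (z ^ (2 * n) / (2 * n)! * w n) := by
      funext n
      simp [hb_def]
    rw [hshift]
    exact hc_sum.hasSum.mul_left _
  -- termwise domination
  have hab : ∀ n, |z ^ (2 * n) / (2 * n)! * (m (2 * n) - ((2 * n)! : ℝ) / (2 ^ n * n !) * V ^ n)|
      ≤ b n := by
    intro n
    rcases lt_or_ge n 2 with hn | hn
    · have h0 : m (2 * n) - ((2 * n)! : ℝ) / (2 ^ n * n !) * V ^ n = 0 := by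
        interval_cases n
        · simp [hm]
        · rw [← hm2]
          norm_num [Nat.factorial]
      have hbn : b n = 0 := by rw [hb_def]; exact if_pos hn
      rw [h0, mul_zero, abs_zero, hbn]
    · obtain ⟨k, rfl⟩ : ∃ k, n = k + 2 := ⟨n - 2, by omega⟩
      have hdevn := hdev (k + 2) hn
      have h2n4 : 2 * (k + 2) - 4 = 2 * k := by omega
      rw [h2n4] at hdevn
      have hfac := two_mul_pow_four_div_factorial_le k
      have hz4 : z ^ (2 * (k + 2)) = z ^ 4 * z ^ (2 * k) := by rw [← pow_add]; ring_nf
      have hbk : b (k + 2) = 16 * E * z ^ 4 * (z ^ (2 * k) / (2 * k)! * w k) := by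
        simp [hb_def]
      rw [hbk, abs_mul, abs_div, Nat.abs_cast, abs_of_nonneg (hz2 (k + 2))]
      calc z ^ (2 * (k + 2)) / (2 * (k + 2))! *
            |m (2 * (k + 2)) - ((2 * (k + 2))! : ℝ) / (2 ^ (k + 2) * (k + 2)!) * V ^ (k + 2)|
          ≤ z ^ (2 * (k + 2)) / (2 * (k + 2))! * ((2 * (k + 2 : ℕ) : ℝ) ^ 4 * E * w k) :=
            mul_le_mul_of_nonneg_left (by exact_mod_cast hdevn)
              (div_nonneg (hz2 _) (by positivity))
        _ = z ^ 4 * ((2 * (k + 2 : ℕ) : ℝ) ^ 4 / (2 * (k + 2))!) * (z ^ (2 * k) * E * w k) := by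
            rw [hz4]; ring
        _ ≤ z ^ 4 * (16 / (2 * k)!) * (z ^ (2 * k) * E * w k) :=
            mul_le_mul_of_nonneg_right
              (mul_le_mul_of_nonneg_left hfac (by positivity))
              (mul_nonneg (mul_nonneg (hz2 k) hE) (hw0 k))
        _ = 16 * E * z ^ 4 * (z ^ (2 * k) / (2 * k)! * w k) := by ring
  -- conclusion: `|D| ≤ B ≤ 16 E z⁴ exp(z² W/2)`
  have hup := hasSum_le (fun n => (le_abs_self _).trans (hab n)) h4 hb
  have hlow := hasSum_le (fun n => (neg_le.mpr ((neg_le_abs _).trans (hab n)) : -b n ≤ _)) hb.neg h4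
  have hB : 16 * E * z ^ 4 * ∑' n, z ^ (2 * n) / (2 * n)! * w n ≤
      16 * E * z ^ 4 * Real.exp (z ^ 2 / 2 * W) :=
    mul_le_mul_of_nonneg_left hc_tsum (by positivity)
  rw [abs_le]
  exact ⟨by linarith, by linarith⟩

open LongRangeIsing

/-! ### `panis_mgfDeviation_le_ursellFourBoxSum` from Aizenman's deviation display and GHS -/

-- names the `@[deprecated]` (refuted) fact `panis_evenMoment_deviation_le` of `…Moments` on purpose: a vacuous record
-- of the printed chain (verdict clean-up 2026-08-16, `…Moments` §Verdict clean-up); REMOVE-WHEN this theorem is retired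
set_option linter.deprecated false in
/-- **`panis_mgfDeviation_le_ursellFourBoxSum` from the deviation display alone** (the summation of
the proof of Panis 2023, Theorem 5.5, "Multiplying by `z^{2n}/(2n)!` and summing over `n`", carried out
by `abs_mgf_sub_exp_le_of_mgf_bound` on the window law of the infinite-volume state, with the
GHS Gaussian domination `state_exp_smeared_le_of_ghs` of `⟨exp(tT_{|f|,L,β})⟩` in place of Newman's
term-by-term domination, and the flip symmetry `⟨T^{2m+1}⟩ = 0`; constant `C₁ = 16 · 3/2 = 24`).
**Vacuous since 2026-08-16:** the hypothesis `panis_evenMoment_deviation_le` is refuted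
(`not_panis_evenMoment_deviation_le_of_criticalBeta_pos`, `…Wick`, with
`panis_criticalBeta_pos_holds`; `…Moments`, §Verdict clean-up) — the conclusion is meanwhile a
theorem outright (`panis_mgfDeviation_le_ursellFourBoxSum_holds`, `panis_thm12_holds`,
`LongRangeTrivialityOnZ3_holds`).
[cite: Panis2023Triviality, proof of Theorem 5.5, first two displays (p. 21)] -/
theorem panis_mgfDeviation_le_ursellFourBoxSum_of_ghs (h51 : panis_evenMoment_deviation_le) :
    panis_mgfDeviation_le_ursellFourBoxSum := by
  intro d hd C₀ α hC₀ hα hexp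
  refine ⟨24, by norm_num, ?_⟩
  intro β hβ hβc L R hL hR f hf hfR z
  set J := algebraicCoupling d C₀ α with hJdef
  have hJ : ∀ x y, 0 ≤ J x y := algebraicCoupling_nonneg hC₀.le α
  have hβ0 : 0 ≤ β := hβ.le
  set B : Finset (Site d) := box d (R * L) with hB
  have hsupp : ∀ x : Site d, f ((L : ℝ)⁻¹ • siteVec x) ≠ 0 → x ∈ B :=
    fun x hx => mem_box_mul_of_apply_ne_zero hfR hL x hx
  have hfaR : ∀ x, (fun x => |f x|) x ≠ 0 → ∀ i, |x i| ≤ R := fun x hx => hfR x (fun h0 => hx (by simp [h0]))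
  have hsuppa : ∀ x : Site d, (fun x => |f x|) ((L : ℝ)⁻¹ • siteVec x) ≠ 0 → x ∈ B :=
    fun x hx => mem_box_mul_of_apply_ne_zero hfaR hL x hx
  -- the window law and the two random variables
  set μ := windowMeasure J β B hβ0 hJ with hμ
  set X : SpinConfig ↥B → ℝ := fun τ => smeared J β L f (glue B τ .free) with hX
  set Y : SpinConfig ↥B → ℝ := fun τ => smeared J β L (fun x => |f x|) (glue B τ .free) with hY
  have hSX : ∀ ψ : ℝ → ℝ, state J β 0 (fun σ => ψ (smeared J β L f σ)) = ∫ τ, ψ (X τ) ∂μ :=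
    fun ψ => state_fun_smeared_eq_integral J β hβ0 hJ L f hsupp ψ
  have hSY : ∀ ψ : ℝ → ℝ, state J β 0 (fun σ => ψ (smeared J β L (fun x => |f x|) σ)) = ∫ τ, ψ (Y τ) ∂μ :=
    fun ψ => state_fun_smeared_eq_integral J β hβ0 hJ L (fun x => |f x|) hsuppa ψ
  -- hypotheses of the summation theorem
  have hXm : Measurable X := measurable_of_finite X
  have hXb : ∀ τ, |X τ| ≤ ∑ τ' : SpinConfig ↥B, |X τ'| := fun τ =>
    Finset.single_le_sum (f := fun τ' => |X τ'|) (fun τ' _ => abs_nonneg _) (Finset.mem_univ τ)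
  have hYm : Measurable Y := measurable_of_finite Y
  have hYb : ∀ τ, |Y τ| ≤ ∑ τ' : SpinConfig ↥B, |Y τ'| := fun τ =>
    Finset.single_le_sum (f := fun τ' => |Y τ'|) (fun τ' _ => abs_nonneg _) (Finset.mem_univ τ)
  set F4 : ℝ := (⨆ x, |f x|) ^ 4 with hF4
  have hF40 : 0 ≤ F4 := pow_nonneg (Real.iSup_nonneg fun x => abs_nonneg (f x)) 4
  set S : ℝ := ursellFourBoxSum J β L R with hS
  have hS0 : 0 ≤ S := ursellFourBoxSum_nonneg J β L R
  set E : ℝ := 3 / 2 * F4 * S with hE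
  have hE0 : 0 ≤ E := by positivity
  have hdev : ∀ n : ℕ, 2 ≤ n →
      |(∫ τ, X τ ^ (2 * n) ∂μ) - ((2 * n)! : ℝ) / (2 ^ n * n !) * (∫ τ, X τ ^ 2 ∂μ) ^ n|
        ≤ (2 * n : ℝ) ^ 4 * E * ∫ τ, Y τ ^ (2 * n - 4) ∂μ := by
    intro n hn
    have h := h51 d hd C₀ α hC₀ hα hexp β hβ hβc L R hL hR f hf hfR n hn
    rw [hSX (fun t => t ^ (2 * n)), hSX (fun t => t ^ 2), hSY (fun t => t ^ (2 * n - 4))] at h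
    calc |(∫ τ, X τ ^ (2 * n) ∂μ) - ((2 * n)! : ℝ) / (2 ^ n * n !) * (∫ τ, X τ ^ 2 ∂μ) ^ n|
        ≤ 3 / 2 * (2 * n : ℝ) ^ 4 * (∫ τ, Y τ ^ (2 * n - 4) ∂μ) * F4 * S := h
      _ = (2 * n : ℝ) ^ 4 * E * ∫ τ, Y τ ^ (2 * n - 4) ∂μ := by rw [hE]; ring
  have hmgf : ∀ t : ℝ, ∫ τ, Real.exp (t * Y τ) ∂μ ≤ Real.exp (t ^ 2 / 2 * ∫ τ, Y τ ^ 2 ∂μ) := by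
    intro t
    have h := state_exp_smeared_le_of_ghs J hJ hβ0 L (fun x => |f x|) (fun x => abs_nonneg _) hsuppa t
    rwa [hSY (fun u => Real.exp (t * u)), hSY (fun u => u ^ 2)] at h
  have hodd : ∀ n : ℕ, ∫ τ, X τ ^ (2 * n + 1) ∂μ = 0 := by
    intro n
    rw [← hSX (fun t => t ^ (2 * n + 1))]
    exact state_smeared_odd_pow J β L f hsupp n
  have key := abs_mgf_sub_exp_le_of_mgf_bound (μ := μ) hXm hXb hYm hYb hE0 hdev hmgf hodd z
  -- back to the state
  have e1 : state J β 0 (fun σ => Real.exp (z * smeared J β L f σ)) = ∫ τ, Real.exp (z * X τ) ∂μ :=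
    hSX fun t => Real.exp (z * t)
  have e2 : state J β 0 (fun σ => smeared J β L f σ ^ 2) = ∫ τ, X τ ^ 2 ∂μ := hSX fun t => t ^ 2
  have e3 : state J β 0 (fun σ => smeared J β L (fun x => |f x|) σ ^ 2) = ∫ τ, Y τ ^ 2 ∂μ := hSY fun t => t ^ 2
  rw [mgfDeviation, e1, e2, e3]
  calc |(∫ τ, Real.exp (z * X τ) ∂μ) - Real.exp (z ^ 2 / 2 * ∫ τ, X τ ^ 2 ∂μ)|
      ≤ 16 * E * z ^ 4 * Real.exp (z ^ 2 / 2 * ∫ τ, Y τ ^ 2 ∂μ) := key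
    _ = 24 * z ^ 4 * Real.exp (z ^ 2 / 2 * ∫ τ, Y τ ^ 2 ∂μ) * F4 * S := by rw [hE]; ring

-- names the `@[deprecated]` (refuted) fact `panis_evenMoment_deviation_le` of `…Moments` on purpose: a vacuous record
-- of the printed chain (verdict clean-up 2026-08-16, `…Moments` §Verdict clean-up); REMOVE-WHEN this theorem is retired
set_option linter.deprecated false in
/-- **Theorem 1.2 from Aizenman's deviation display and the bound on `S(β,L,f)`** — Newman's
Gaussian domination is no longer an input.
**Vacuous since 2026-08-16:** the hypothesis `panis_evenMoment_deviation_le` is refuted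
(`not_panis_evenMoment_deviation_le_of_criticalBeta_pos`, `…Wick`, with
`panis_criticalBeta_pos_holds`; `…Moments`, §Verdict clean-up) — the conclusion is meanwhile a
theorem outright (`panis_mgfDeviation_le_ursellFourBoxSum_holds`, `panis_thm12_holds`,
`LongRangeTrivialityOnZ3_holds`).
[cite: Panis2023Triviality, proof of Theorem 5.5 (pp. 21–22)] -/
theorem panis_thm12_of_ghs (h51 : panis_evenMoment_deviation_le) (hS : panis_ursellFourBoxSum_le) :
    panis_thm12 :=
  panis_thm12_of_inputs (panis_mgfDeviation_le_ursellFourBoxSum_of_ghs h51) hS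

-- names the `@[deprecated]` (refuted) fact `panis_evenMoment_deviation_le` of `…Moments` on purpose: a vacuous record
-- of the printed chain (verdict clean-up 2026-08-16, `…Moments` §Verdict clean-up); REMOVE-WHEN this theorem is retired
set_option linter.deprecated false in
/-- **Theorem 1.2 on `ℤ³` from four printed facts**: Aizenman's deviation display
(`panis_evenMoment_deviation_le`), the tree diagram bound (`panis_treeDiagramBound`), the
sliding-scale infrared bound (`panis_slidingScale_infraredBound`) and the infrared bound for the
algebraic couplings (`panis_infraredBound_algebraic`) — the Messager–Miracle-Solé monotonicity, the
inequality `χ_L ≤ C L^{-d}Σ_L` and the Gaussian domination being theorems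
(`panis_mms_two_point_monotone_holds`, `panis_boxSusceptibility_le_blockVariance_holds`,
`state_exp_smeared_le_of_ghs`).
**Vacuous since 2026-08-16:** the hypothesis `panis_evenMoment_deviation_le` is refuted
(`not_panis_evenMoment_deviation_le_of_criticalBeta_pos`, `…Wick`, with
`panis_criticalBeta_pos_holds`; `…Moments`, §Verdict clean-up) — the conclusion is meanwhile a
theorem outright (`panis_mgfDeviation_le_ursellFourBoxSum_holds`, `panis_thm12_holds`,
`LongRangeTrivialityOnZ3_holds`).
[cite: Panis2023Triviality, Theorem 1.2 and proof of Theorem 5.5] -/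
theorem panis_thm12_dim3_of_ghs (h51 : panis_evenMoment_deviation_le) (hT : panis_treeDiagramBound)
    (hSS : panis_slidingScale_infraredBound) (hI : panis_infraredBound_algebraic) : panis_thm12_dim3 :=
  panis_thm12_dim3_of_twoPoint (panis_mgfDeviation_le_ursellFourBoxSum_of_ghs h51) hT
    panis_mms_two_point_monotone_holds hSS hI panis_boxSusceptibility_le_blockVariance_holds

-- names the `@[deprecated]` (refuted) fact `panis_evenMoment_deviation_le` of `…Moments` on purpose: a vacuous record
-- of the printed chain (verdict clean-up 2026-08-16, `…Moments` §Verdict clean-up); REMOVE-WHEN this theorem is retired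
set_option linter.deprecated false in
/-- **The barrier `LongRangeTrivialityOnZ3` from four printed facts** (random currents: the deviation
display and the tree diagram bound; reflection positivity: the sliding-scale and the algebraic
infrared bounds).
**Vacuous since 2026-08-16:** the hypothesis `panis_evenMoment_deviation_le` is refuted
(`not_panis_evenMoment_deviation_le_of_criticalBeta_pos`, `…Wick`, with
`panis_criticalBeta_pos_holds`; `…Moments`, §Verdict clean-up) — the conclusion is meanwhile a
theorem outright (`panis_mgfDeviation_le_ursellFourBoxSum_holds`, `panis_thm12_holds`,
`LongRangeTrivialityOnZ3_holds`).
[cite: Panis2023Triviality, Theorem 1.2 and proof of Theorem 5.5] -/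
theorem LongRangeTrivialityOnZ3.of_ghs (h51 : panis_evenMoment_deviation_le) (hT : panis_treeDiagramBound)
    (hSS : panis_slidingScale_infraredBound) (hI : panis_infraredBound_algebraic) : LongRangeTrivialityOnZ3 :=
  LongRangeTrivialityOnZ3.of_thm12_dim3 (panis_thm12_dim3_of_ghs h51 hT hSS hI)

end Literature.Barriers.CriticalPhenomena

end
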